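import Mathlib
import Summits.NavierStokesRegularity.NavierStokesRegularity.Theses.LerayQuarterDissipation
import HarnessLib

/-!
# `LerayQuarterDissipation.FiniteDissipationLiouvilleGlue` — glue of the gen-1 split of
`FiniteDissipationLiouville` (item stmt-NavierStokesRegularity-22509; pure logic)

**Statement.** `RecurrentReductionD → RecurrentDissipativeLiouville → FiniteDissipationLiouville`.

PROOF. Let `ū` be a Type-I ancient mild solution (KNSS gauge, constant `C`) with the global
quarter-rate dissipation law (constant `K`) and suppose, for contradiction, that it is unbounded on
every backward parabolic cylinder at the origin. Child 1 (`RecurrentReductionD`) produces a member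
`w` of the same finite-dissipation stratum that is uniformly recurrent under the Navier–Stokes
scaling flow and still unbounded on every backward cylinder; child 2
(`RecurrentDissipativeLiouville`) says such a `w` is bounded on some backward cylinder —
contradiction.

HONEST FRAMING: pure logic between the route's own statements (children ⟹ parent); both children
stay hypotheses (child 2 is an open crux); nothing here bears on Navier–Stokes regularity itself.
-/

noncomputable section

set_option linter.dupNamespace false

namespace Summit.NavierStokesRegularity.NavierStokesRegularity.Theorems

open Summit.NavierStokesRegularity.NavierStokesRegularity.Theses.LerayQuarterDissipation in
/-- **Item stmt-NavierStokesRegularity-22509** (`LerayQuarterDissipation.FiniteDissipationLiouvilleGlue`):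
the two gen-1 children `RecurrentReductionD` (a singular member of the finite-dissipation stratum
yields a uniformly recurrent singular member) and `RecurrentDissipativeLiouville` (uniformly
recurrent members are bounded near the apex) imply the parent `FiniteDissipationLiouville`.
Pure logic. [this file] -/
theorem finiteDissipationLiouvilleGlue_proof :
    Summit.NavierStokesRegularity.NavierStokesRegularity.Theses.LerayQuarterDissipation.FiniteDissipationLiouvilleGlue := by
  unfold
    Summit.NavierStokesRegularity.NavierStokesRegularity.Theses.LerayQuarterDissipation.FiniteDissipationLiouvilleGlue
  intro h₁ h₂ C K u hu hlaw hsing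
  obtain ⟨C', K', w, hw, hlaw', hrec, hsing'⟩ := h₁ C K u hu hlaw hsing
  exact h₂ C' K' w hw hlaw' hrec hsing'

end Summit.NavierStokesRegularity.NavierStokesRegularity.Theorems

end
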